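/-
Fleet lead `ym-wcr-19609-p1` (seat prover-ym-wcr-19609-p1-g2-0), route `WeakCouplingRates`, crux `BulkDominatesColdBoxW`
(stmt-QuantumFields-19609), line `dlr-chessboard` (v6): TWO-CONSTANT form of the A-mean core (global YM bound `M₀` vs on-`S` bound `M`).
-/
import Summits.QuantumFields.YangMills.Theorems.WeakCouplingRatesBulkDominatesColdBoxWKernelGoodEvent
import Summits.QuantumFields.YangMills.Theorems.WeakCouplingRatesBulkDominatesColdBoxWMeanBookkeeping

/-!
# Crux `BulkDominatesColdBoxW`, stub `stub_kernelMeanExpansion`: the A-mean CORE with the two observable bounds separated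

`abs_kernelMean_sub_gaussian_le_core` (seat ym-spine-20043-p1, `…KernelMeanCore`) bounds `|β·E_{γ(·|ω)} c_x − ((3/2)C_D(q',q') + ½Σ_c F_c²)|` with ONE
constant `M` serving both as the global bound `|βc_x| ≤ M` (YM conditioning) and as the bound on the Gaussian good event `S` (tilt term
`M(e^{2w} − 1)`).  In the application the global bound is `4β` while on `S` it is `β^{2ε}`; with a single constant the tilt term is not small.  This file
gives the two-constant form the assembler instantiates:

  `|β·E c_x − ((3/2)C + ½ΣF²)| ≤ 2M₀·pY + M(e^{2w} − 1) + τ + 2(1 + 6Σ_c(F_c⁴ + 3C²))·√p`   (`abs_kernelMean_sub_gaussian_le_core₂`),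

from `abs_integral_sub_integral_cond_le` (YM side, `M₀`), `abs_mean_tilted_cond_sub_le` (`…MeanBookkeeping`, on-`S` bound `M`, `p ≤ ½`),
`integral_quadObs_sq_pi_le` and `integral_quadObs_pi_eq` (seat ym-spine-20043-p1).  No new definition; standard axioms.  NOT a claim about the mass gap.
-/

set_option autoImplicit false

noncomputable section

open MeasureTheory ProbabilityTheory Finset
open Literature.Probability.LatticeModels Literature.MathematicalPhysics.QuantumLattice
open Literature.MathematicalPhysics.QuantumFieldTheory

namespace Summit.QuantumFields.YangMills.Theorems.WeakCouplingRates

/-- **A-mean core, two constants.**  See the module docstring. -/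
theorem abs_kernelMean_sub_gaussian_le_core₂ {H : ℕ} {β : ℝ} (ω : LGConfig 4 (Matrix.specialUnitaryGroup (Fin 2) ℂ))
    (x : Site 4) (i j : Fin 4)
    {G : Set (LGConfig 4 (Matrix.specialUnitaryGroup (Fin 2) ℂ))} (hG : MeasurableSet G) (hG0 : boxKernel β H ω G ≠ 0)
    {pY : ℝ} (hpY : (boxKernel β H ω).real Gᶜ ≤ pY)
    {M₀ M : ℝ} (hM : 0 ≤ M) (hfM : ∀ U, |β * plaqCostAt (fundamentalRep (Fin 2)) x i j U| ≤ M₀)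
    (cfg : (Fin 3 → EuclideanSpace ℝ (DirFree H)) → LGConfig 4 (Matrix.specialUnitaryGroup (Fin 2) ℂ)) (hcfg : Measurable cfg)
    {S : Set (Fin 3 → EuclideanSpace ℝ (DirFree H))} (hS : MeasurableSet S) (hS0 : (Measure.pi fun _ : Fin 3 => boxDirichlet H) S ≠ 0)
    {p : ℝ} (hp : (Measure.pi fun _ : Fin 3 => boxDirichlet H).real Sᶜ ≤ p) (hp2 : p ≤ 1 / 2)
    {W : (Fin 3 → EuclideanSpace ℝ (DirFree H)) → ℝ} (hWm : Measurable W) {w : ℝ} (hW : ∀ t, |S.indicator W t| ≤ w)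
    (hRep : ∫ U, β * plaqCostAt (fundamentalRep (Fin 2)) x i j U ∂((boxKernel β H ω)[|G]) =
      ∫ t, β * plaqCostAt (fundamentalRep (Fin 2)) x i j (cfg t)
        ∂(((Measure.pi fun _ : Fin 3 => boxDirichlet H)[|S]).tilted (S.indicator W)))
    (F : Fin 3 → ℝ) (q' : Plaq 4) {τ : ℝ}
    (hFS : ∀ t ∈ S, |β * plaqCostAt (fundamentalRep (Fin 2)) x i j (cfg t)| ≤ M)
    (hSur : ∀ t ∈ S, |β * plaqCostAt (fundamentalRep (Fin 2)) x i j (cfg t) - (1 / 2 : ℝ) * ∑ c, (F c + dirCirc H q' (t c)) ^ 2| ≤ τ) :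
    |β * (∫ U, plaqCostAt (fundamentalRep (Fin 2)) x i j U ∂(boxKernel β H ω)) -
        (3 / 2 * boxDirProjKernel H q' q' + 1 / 2 * ∑ c, F c ^ 2)| ≤
      2 * M₀ * pY + (M * (Real.exp (2 * w) - 1) + τ +
        2 * (1 + 6 * ∑ c, (F c ^ 4 + 3 * boxDirProjKernel H q' q' ^ 2)) * Real.sqrt p) := by
  haveI : IsProbabilityMeasure (boxKernel β H ω) := isProbabilityMeasure_boxKernel β H ω
  set μ := boxKernel β H ω with hμ
  set γ : Measure (Fin 3 → EuclideanSpace ℝ (DirFree H)) := Measure.pi fun _ : Fin 3 => boxDirichlet H with hγ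
  set f : LGConfig 4 (Matrix.specialUnitaryGroup (Fin 2) ℂ) → ℝ := fun U => β * plaqCostAt (fundamentalRep (Fin 2)) x i j U with hf
  set Q : (Fin 3 → EuclideanSpace ℝ (DirFree H)) → ℝ := fun t => (1 / 2 : ℝ) * ∑ c, (F c + dirCirc H q' (t c)) ^ 2 with hQ
  have hfm : Measurable f := measurable_const.mul (measurable_plaqCostAt x i j)
  have hfi : Integrable f μ := integrable_of_abs_le hfm.aestronglyMeasurable hfM
  have hM₀ : 0 ≤ M₀ := (abs_nonneg _).trans (hfM (fun _ => 1))
  -- (1) YM conditioning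
  have h1 : |(∫ U, f U ∂μ) - ∫ U, f U ∂(μ[|G])| ≤ 2 * M₀ * pY := by
    have key := abs_integral_sub_integral_cond_le (μ := μ) hG hG0 hfi hfM
    have h2 : 0 ≤ 2 * M₀ := by linarith
    exact key.trans (mul_le_mul_of_nonneg_left hpY h2)
  -- (2)+(3) representation and mean bookkeeping on the Gaussian side
  have hQ2 : MemLp Q 2 γ := memLp_two_quadObs_pi F q'
  have hFm : Measurable fun t => f (cfg t) := hfm.comp hcfg
  have h3 := abs_mean_tilted_cond_sub_le (γ := γ) hS hS0 hWm hW (F := fun t => f (cfg t)) (Q := Q) hFm hQ2 hM hFS hSur hp hp2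
  have hQsq : ∫ t, Q t ^ 2 ∂γ ≤ 6 * ∑ c, (F c ^ 4 + 3 * boxDirProjKernel H q' q' ^ 2) := integral_quadObs_sq_pi_le (H := H) F q'
  have hsqrt0 : 0 ≤ Real.sqrt p := Real.sqrt_nonneg _
  have h3' : |(∫ t, f (cfg t) ∂((γ[|S]).tilted (S.indicator W))) - ∫ t, Q t ∂γ| ≤
      M * (Real.exp (2 * w) - 1) + τ + 2 * (1 + 6 * ∑ c, (F c ^ 4 + 3 * boxDirProjKernel H q' q' ^ 2)) * Real.sqrt p := by
    refine h3.trans ?_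
    have : 2 * (1 + ∫ t, Q t ^ 2 ∂γ) * Real.sqrt p ≤ 2 * (1 + 6 * ∑ c, (F c ^ 4 + 3 * boxDirProjKernel H q' q' ^ 2)) * Real.sqrt p := by
      apply mul_le_mul_of_nonneg_right _ hsqrt0
      linarith
    linarith
  -- (4) the exact Gaussian value
  have h4 : ∫ t, Q t ∂γ = 3 / 2 * boxDirProjKernel H q' q' + 1 / 2 * ∑ c, F c ^ 2 := integral_quadObs_pi_eq F q'
  -- assemble
  have e0 : β * (∫ U, plaqCostAt (fundamentalRep (Fin 2)) x i j U ∂μ) = ∫ U, f U ∂μ := by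
    rw [hf, integral_const_mul]
  rw [e0, ← h4]
  have hrep' : ∫ U, f U ∂(μ[|G]) = ∫ t, f (cfg t) ∂((γ[|S]).tilted (S.indicator W)) := hRep
  rw [hrep'] at h1
  calc |(∫ U, f U ∂μ) - ∫ t, Q t ∂γ|
      ≤ |(∫ U, f U ∂μ) - ∫ t, f (cfg t) ∂((γ[|S]).tilted (S.indicator W))| +
          |(∫ t, f (cfg t) ∂((γ[|S]).tilted (S.indicator W))) - ∫ t, Q t ∂γ| := abs_sub_le _ _ _
    _ ≤ _ := add_le_add h1 h3'

end Summit.QuantumFields.YangMills.Theorems.WeakCouplingRates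

end
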